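import Summits.HodgeConjecture.CorCM.Census.CentralSquaresPartnersTies

/-!
# The square-central class, LVIII: the far-partner hypotheses of the multi-partner frame from intersection counts

COR-CM (cell `pub-hodgecm2`), count-neutral kernel combinatorics by the binder seat b09 (gen 50; lane SQUARE-CENTRAL CLASS, part LVIII), on part LVII
(`card_symmDiff_add_two_mul_card_inter`), part L (`card_symmDiff_le_add`) and part III (`ddist_eq_card_symmDiff`, `ddist_compl_eq`), BY NAME.  Theorems
only: no definition, no `decide`, no certificate, no named fact, no `sorry`.  HONEST FRAMING: `HC_CM` is NOT proved, here or anywhere in the tree; nothing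
here is a period or a headline.

Parts LIII–LVI carry FAR-PARTNER HYPOTHESES: every other partner `T₂` and its complement are strictly farther than the base type `B` (`= T₀`, or `T₁`,
or `T̄₁` in the exchanged / companion frames) from every type of a level-`(m+2)` class `D_B(X) ⊆ W ∪ {a, a'}` (`W` a transversal of size `m` inside
`B ∖ B'`, `a, a'` outside).  With `|B| = 4m` and `|B ∖ T₂| = 2m` the two distances are `|D| + 2m − 2|D ∩ (B ∖ T₂)|` and `2m − |D| + 2|D ∩ (B ∖ T₂)|`, and
`|D ∩ (B ∖ T₂)|` is pinned by `|W ∩ (B ∖ T₂)|` up to the two outside places and the at most two places of `W` missing from `D`; so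
**`3 ≤ |W ∩ (B ∖ T₂)| ≤ m − 3`** suffices (`far_of_inter_bounds`) — ONE lemma for all three frames, stated for an arbitrary base type `B`.  In the rank-two
affine blocks `|W ∩ (B ∖ T₂)| = m/2`, so the hypotheses of the all-dihedral multi-partner law (part LVI) hold as soon as `m ≥ 8`.

## References
* [Pohlmann1968] H. Pohlmann, Algebraic cycles on abelian varieties of complex multiplication type, Ann. of Math. 88 (1968), Thm 1.
-/

namespace Summit.HodgeConjecture.CorCM.Census.CentralSquares

open Finset
open scoped symmDiff
open Summit.HodgeConjecture.CorCM.Prior.AllgGroup.RfwfAllgGroup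
open Summit.HodgeConjecture.CorCM.Census.BlockParity
open Summit.HodgeConjecture.CorCM.Census.Coinvariant
open Summit.HodgeConjecture.CorCM.Census.TwistGeneration
open Summit.HodgeConjecture.CorCM.Census.BaseBlock

noncomputable section

variable {G : Type*} [Group G] [Fintype G] [DecidableEq G] (c : G)

/-- **FAR PARTNERS from intersection counts.**  `B` a base type with `|B| = 4m`, `T₂` a type with `|B ∖ T₂| = 2m`, `W ⊆ B` of size `m` with
`3 ≤ |W ∩ (B ∖ T₂)| ≤ m − 3`, and `a, a'` two places: for every type `X` with `B ∖ X ⊆ W ∪ {a, a'}`, both `T₂` and `T̄₂` are strictly farther from `X`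
than `B` is (`|B ∖ X| < ddist T₂ X`, `|B ∖ X| < ddist T̄₂ X`). [folklore] -/
theorem far_of_inter_bounds (hc2 : c * c = 1) (hcen : ∀ x : G, x * c = c * x) (B T₂ : CMF G c) (m : ℕ) (hn : B.1.card = 4 * m)
    (hH₂ : (B.1 \ T₂.1).card = 2 * m) (W : Finset G) (hWm : W.card = m)
    (hlo : 3 ≤ (W ∩ (B.1 \ T₂.1)).card) (hhi : (W ∩ (B.1 \ T₂.1)).card + 3 ≤ m) (a a' : G) :
    ∀ X : CMF G c, B.1 \ X.1 ⊆ W ∪ {a, a'} → (B.1 \ X.1).card < ddist T₂ X ∧ (B.1 \ X.1).card < ddist (rt c c T₂) X := by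
  intro X hX
  set D := B.1 \ X.1 with hD
  set H₂ := B.1 \ T₂.1 with hH₂def
  -- `|D ∩ H₂| ≤ |W ∩ H₂| + 2`
  have hup : (D ∩ H₂).card ≤ (W ∩ H₂).card + 2 := by
    calc (D ∩ H₂).card ≤ ((W ∩ H₂) ∪ {a, a'}).card := card_le_card fun x hx => by
            obtain ⟨hxD, hxH⟩ := mem_inter.mp hx
            rcases mem_union.mp (hX hxD) with h | h
            · exact mem_union_left _ (mem_inter.mpr ⟨h, hxH⟩)
            · exact mem_union_right _ h
      _ ≤ (W ∩ H₂).card + ({a, a'} : Finset G).card := card_union_le _ _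
      _ ≤ (W ∩ H₂).card + 2 := by have := card_insert_le a ({a'} : Finset G); rw [card_singleton] at this; omega
  -- `|D| ≤ |D ∩ W| + 2` and `|W ∩ H₂| ≤ |D ∩ H₂| + (|W| − |D ∩ W|)`
  have hDW : D.card ≤ (D ∩ W).card + 2 := by
    calc D.card ≤ ((D ∩ W) ∪ {a, a'}).card := card_le_card fun x hxD => by
            rcases mem_union.mp (hX hxD) with h | h
            · exact mem_union_left _ (mem_inter.mpr ⟨hxD, h⟩)
            · exact mem_union_right _ h
      _ ≤ (D ∩ W).card + ({a, a'} : Finset G).card := card_union_le _ _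
      _ ≤ (D ∩ W).card + 2 := by have := card_insert_le a ({a'} : Finset G); rw [card_singleton] at this; omega
  have hlow : (W ∩ H₂).card ≤ (D ∩ H₂).card + (W \ D).card := by
    calc (W ∩ H₂).card ≤ ((D ∩ H₂) ∪ (W \ D)).card := card_le_card fun x hx => by
            obtain ⟨hxW, hxH⟩ := mem_inter.mp hx
            by_cases hxD : x ∈ D
            · exact mem_union_left _ (mem_inter.mpr ⟨hxD, hxH⟩)
            · exact mem_union_right _ (mem_sdiff.mpr ⟨hxW, hxD⟩)
      _ ≤ (D ∩ H₂).card + (W \ D).card := card_union_le _ _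
  have hWD : (W \ D).card + (D ∩ W).card = W.card := by
    rw [inter_comm]; exact card_sdiff_add_card_inter W D
  have hDle : D.card ≤ m + 2 := by
    have h := card_le_card (inter_subset_right : D ∩ W ⊆ W); omega
  -- the two distances
  have hsd := card_symmDiff_add_two_mul_card_inter H₂ D
  rw [inter_comm] at hsd
  have hsdle : (H₂ ∆ D).card ≤ H₂.card + D.card := card_symmDiff_le_add _ _
  constructor
  · rw [ddist_eq_card_symmDiff c B hc2 T₂ X]
    change D.card < (H₂ ∆ D).card
    omega
  · rw [ddist_compl_eq c B hc2 hcen T₂ X, hn]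
    change D.card < 4 * m - (H₂ ∆ D).card
    omega

end

end Summit.HodgeConjecture.CorCM.Census.CentralSquares
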